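import Literature.MathematicalPhysics.QuantumFieldTheory.Balaban1983to89.B9RWSums346MixedPair
import Literature.MathematicalPhysics.QuantumFieldTheory.Balaban1983to89.B9Thm310WholeDir

/-!
# `Balaban1983to89.B9RWSums346MixedPairGDir` — the mixed L² member (3.46) of Theorem 3.10's sum G(U), per direction pair, OVER THE DIRECTION LETTERS (R1′-A): n06-k's `B9RWSums346MixedPair` G-side faces with `Identities310₂`

T. Bałaban, *Propagators for lattice gauge theories in a background field*, Commun. Math. Phys. **99** (1985) 389–434
[`Balaban1985BackgroundPropagators`, "B9"], Thm 3.10 (3.105)–(3.108) pp. 414–416, (3.43)–(3.46) p. 398, (3.42) p. 397, Cor. 3.6 p. 408; T. Bałaban,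
*Propagators and renormalization transformations for lattice gauge theories. II*, Commun. Math. Phys. **96** (1984) 223–250 [`Balaban1984PropagatorsII`, "[4]"],
(2.52)–(2.55) p. 232, Lemma 2.1 p. 234.

statement-level skeleton of published theorems with citation tags; proofs where landed; nothing here is a claim about the
Yang–Mills mass gap

WHY THIS FILE (cell `pub-ymgap`, Track A node N06 [B9], row 19; seat `pub-ymgap-dag-n06-c` g10, LOCATED-9 bus l.32219, R1′-A).  The G-side member faces of
the lineage take `hi : Identities310`; over the direction letters they take `hi : Identities310₂ 𝔬 𝔡 𝔩 R H U` (`B9Thm310WholeDir`) — a TYPE-ONLY re-thread: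
every proof reads `hi` through `inv ∕ invT ∕ eq3105 ∕ eq3105T` only, which `Identities310₂` keeps verbatim.  v1 private helpers are copied (private there);
statements, constants and every other hypothesis VERBATIM.

HONEST SCOPE.  Majorant bookkeeping over n06-k's landed calculus; legs, factor bounds and (3.105)–(3.106) are HYPOTHESES (schemas); nothing of [B9] asserted;
COUNT-NEUTRAL; N06 NOT discharged; one finite lattice programme — nothing continuum, nothing about OS positivity or the mass gap.
-/

namespace Literature.MathematicalPhysics.QuantumFieldTheory.Balaban1983to89.B9RWSums346MixedPairGDir

open Finset B6RandomWalk B6RandomWalkHom B9Thm37Sum B9Thm34Ext B9Thm37Glue B9Thm37Whole B9Cor38Whole B9Thm310Whole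
open B9RWSums343to347Whole B9RWSums346Schur B9Thm37GlueCor36 B9RWSums346Two B9RWSums346TwoGp B11SectG B9Thm37AllNorms B9SectDL2Decay
open B9RWSums346SecondDiff B9RWSums346SecondDiffGp
open B9RWSums346MixedPair B9Thm37WholeDir B9Thm310WholeDir

noncomputable section

section Algebra

variable {g : B9.Geometry} [Fintype g.Site] {R : ℝ} {H : Prop} {X Z : Type} [Fintype X] [Fintype Z]

omit [Fintype g.Site] [Fintype X] [Fintype Z] in
/-- Algebra of (3.106)∕(3.88) read between two operators: L∘(G∘D) = Σ-free form L∘(G₀∘D) + (L∘G)∘(W∘D) from G = G₀ + G·W. [folklore] -/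
private theorem sandwich_split {L Dst G G0 W : Module.End ℝ (X → ℝ)} (h : G = G0 + G * W) :
    L ∘ₗ (G ∘ₗ Dst) = L ∘ₗ (G0 ∘ₗ Dst) + (L ∘ₗ G) ∘ₗ (W ∘ₗ Dst) := by
  conv_lhs => rw [h]
  apply LinearMap.ext
  intro f
  simp only [LinearMap.comp_apply, LinearMap.add_apply, Module.End.mul_apply, map_add]

omit [Fintype g.Site] [Fintype X] [Fintype Z] in
/-- a left factor distributes over a finite sum of operators composed on the right. [folklore] -/
private theorem comp_sum_comp {ι : Type} [Fintype ι] (L Dst : Module.End ℝ (X → ℝ)) (T : ι → Module.End ℝ (X → ℝ)) :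
    L ∘ₗ ((∑ i, T i) ∘ₗ Dst) = ∑ i, L ∘ₗ (T i ∘ₗ Dst) := by
  apply LinearMap.ext
  intro f
  simp only [LinearMap.comp_apply, LinearMap.sum_apply, map_sum]

omit [Fintype g.Site] [Fintype X] [Fintype Z] in
/-- a finite sum of operators composed on the right. [folklore] -/
private theorem sum_comp' {ι : Type} [Fintype ι] (Dst : Module.End ℝ (X → ℝ)) (T : ι → Module.End ℝ (X → ℝ)) :
    (∑ i, T i) ∘ₗ Dst = ∑ i, T i ∘ₗ Dst := by
  apply LinearMap.ext
  intro f
  simp only [LinearMap.comp_apply, LinearMap.sum_apply]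

/-- L² block bounds add. [folklore] -/
private theorem blockBd_add₃ (blk₁ : X → g.Site) (blk₂ : Z → g.Site) {T₁ T₂ : (X → ℝ) →ₗ[ℝ] (Z → ℝ)}
    {K₁ K₂ : g.Site → g.Site → ℝ} (h₁ : BlockBd (g := toB6 g R H) blk₁ blk₂ T₁ K₁)
    (h₂ : BlockBd (g := toB6 g R H) blk₁ blk₂ T₂ K₂) :
    BlockBd (g := toB6 g R H) blk₁ blk₂ (T₁ + T₂) (fun a b => K₁ a b + K₂ a b) := by
  rw [blockBd_iff_hasMaj] at h₁ h₂ ⊢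
  exact h₁.add h₂

end Algebra

section GSide

variable {g : B9.Geometry} [Fintype g.Site] [DecidableEq g.Site] {R : ℝ} {H : Prop} {B : B9.Backgrounds}
variable {X Y ι A P : Type} [Fintype P]

/-- ★ **THE MIXED L² MEMBER OF (3.46) FOR THE SUM G(U) OF (3.107), PER DIRECTION PAIR** — the L² block bound of ∇_{U,ν}G∇\*_{U,μ}: (3.106)
read as ∇_νG∇\*_μ = Σ_□ ∇_ν(h_□G_□h_□)∇\*_μ + (∇_νG)(R∇\*_μ) (`fixedPoint_of_388`); the head legs summed with N_M; the Schur block bound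
C·L₀·Lʲη·e^{−(1−α)δd} of ∇_νG (`blockBd_entry1` from the components of the (3.42) sup majorants and the transposes (∇_νG)ᵀ = G∇\*_ν);
the factors summed with N_F; `comp_l2_transfer` at q = 1: ‖1_{Δ(y)}∇_νG∇\*_μμ‖₂ ≦ `mixedConst …`·e^{−(1−2α)δd(y,y′)}‖μ‖₂ for supp μ ⊂ Δ(y′),
provided 2αδ ≦ δ and (1 − 2α)δ ≦ (1 − α₁)δ₁.
[cite: Balaban1985BackgroundPropagators, Thm 3.10 (3.105)–(3.108) pp.414–416 + (3.46) p.398 + (3.42) p.397 + p.413 + p.391; Balaban1984PropagatorsII, (2.52)–(2.55) p.232 + Lemma 2.1 p.234] -/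
theorem l2mixed_of_local310_dir [Fintype X] [DecidableEq X] [Fintype Y] [Fintype ι] [Fintype A]
    (𝔬 : Ops310 g B X Y ι A) (𝔡 : DirOps310 𝔬 P) (𝔩 : DirLetters310 𝔬 P) (R : ℝ) (H : Prop) (d d₁ : ℕ) (δ α L₀ δ₁ α₁ ρ N N' NF Cℓ NM BM θM C : ℝ)
    (κ : Sizes310) (SM : ι → Finset g.Site) (U : B.Cfg)
    (hNF : 0 ≤ NF) (hNM : 0 ≤ NM) (hBM : 0 ≤ BM) (hθM : 0 ≤ θM) (hM : 1 ≤ g.M) (hC : 0 ≤ C)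
    (hα2 : 2 * α * δ ≤ δ) (hα₁δ₁ : 0 ≤ α₁ * δ₁) (hrate : (1 - 2 * α) * δ ≤ (1 - α₁) * δ₁)
    (hs : StaticOK310 𝔬 ρ N N' NF Cℓ κ) (hcntM : ∀ a : g.Site, (∑ i, if a ∈ SM i then (1 : ℝ) else 0) ≤ NM)
    (h261 : Ineq261 d₁ (toB6 g R H) δ₁ α₁) (hF : Facts347 g R H d δ α L₀) (hi : Identities310₂ 𝔬 𝔡 𝔩 R H U)
    (hL : L2MixedLegs310 𝔬 𝔡 R H SM BM δ₁ U) (hFL : FactorsL2Mixed310 𝔬 𝔡 R H θM δ₁ U)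
    (hDS : DirSup310 𝔬 𝔡 R H U) (hDT : DirTranspose310 𝔬 𝔡 U)
    (h1 : HasMajorantHom (g := toB6 g R H) 𝔬.blk 𝔬.blkY (𝔬.D U ∘ₗ 𝔬.G U)
      (fun (a b : g.Site) => C * g.len a * Real.exp (-(δ * g.dist a b))))
    (h2 : HasMajorantHom (g := toB6 g R H) 𝔬.blkY 𝔬.blk (𝔬.G U ∘ₗ 𝔬.Dstar U)
      (fun (a b : g.Site) => C * g.len a * Real.exp (-(δ * g.dist a b))))
    (hsym : IsTransposePair (𝔬.G U) (𝔬.G U)) (ν μ : P) :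
    BlockBd (g := toB6 g R H) 𝔬.blk 𝔬.blk (𝔡.Dd U ν ∘ₗ (𝔬.G U ∘ₗ 𝔡.Dsd U μ))
      (fun (a b : g.Site) => mixedConst d₁ δ₁ α₁ NM BM NF θM C L₀ * Real.exp (-((1 - 2 * α) * δ * g.dist a b))) := by
  have hMpos : 0 < g.M := lt_of_lt_of_le one_pos hM
  have hMinv : g.M⁻¹ ≤ 1 := inv_le_one_of_one_le₀ hM
  have hMinv0 : 0 ≤ g.M⁻¹ := inv_nonneg.mpr hMpos.le
  have hlen0 : ∀ y : g.Site, 0 ≤ g.len y := fun y => (hs.lenpos y).le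
  have htri : Triangle254 (toB6 g R H) := fun a b c => hs.tri a b c
  have hc1 : 0 ≤ B6.c1 d₁ δ₁ α₁ := c1_nonneg d₁ δ₁ α₁
  have hL₀ : 0 ≤ L₀ := le_trans (le_trans zero_le_one hF.one_le_L) hF.L_le
  have hρ'0 : 0 ≤ (1 - 2 * α) * δ := by nlinarith [hα2]
  have hexp : ∀ a b : g.Site, Real.exp (-(δ₁ * g.dist a b)) ≤ Real.exp (-((1 - 2 * α) * δ * g.dist a b)) := fun a b =>
    Real.exp_le_exp.mpr (neg_le_neg (mul_le_mul_of_nonneg_right (by nlinarith [hrate, hα₁δ₁]) (hs.dnn a b)))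
  -- (3.106), read between ∇_ν and ∇*_μ
  have hfix : 𝔬.G U = (∑ i, mulOp (𝔬.h i) * 𝔬.Gsq U i * mulOp (𝔬.h i)) + 𝔬.G U * ∑ a, 𝔬.Rf U a :=
    fixedPoint_of_388 hi.inv hi.eq3105
  have hsplit : 𝔡.Dd U ν ∘ₗ (𝔬.G U ∘ₗ 𝔡.Dsd U μ) =
      (∑ i, 𝔡.Dd U ν ∘ₗ ((mulOp (𝔬.h i) * 𝔬.Gsq U i * mulOp (𝔬.h i)) ∘ₗ 𝔡.Dsd U μ)) +
        (𝔡.Dd U ν ∘ₗ 𝔬.G U) ∘ₗ ((∑ a, 𝔬.Rf U a) ∘ₗ 𝔡.Dsd U μ) := by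
    rw [sandwich_split hfix, comp_sum_comp]
  -- the factors R_a∇*_μ summed with N_F
  have hP : BlockBd (g := toB6 g R H) 𝔬.blk 𝔬.blk ((∑ a, 𝔬.Rf U a) ∘ₗ 𝔡.Dsd U μ)
      (fun (y y' : g.Site) => NF * (θM * g.M⁻¹) * g.len y ^ (-(1 : ℝ)) * Real.exp (-(δ₁ * g.dist y y'))) := by
    rw [sum_comp']
    have h := blockBd_localSum (R := R) (H := H) 𝔬.blk 𝔬.blk (fun a => 𝔬.Rf U a ∘ₗ 𝔡.Dsd U μ)
      (fun a (y : g.Site) => if y ∈ 𝔬.SF a then (1 : ℝ) else 0)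
      (fun (y y' : g.Site) => θM * g.M⁻¹ * g.len y ^ (-1 : ℝ) * Real.exp (-(δ₁ * g.dist y y'))) NF
      (fun y y' => mul_nonneg (mul_nonneg (mul_nonneg hθM hMinv0) (Real.rpow_nonneg (hlen0 y) _)) (Real.exp_nonneg _))
      (fun a => hFL.facDs a μ) hs.cntF
    exact h.mono fun y y' => le_of_eq (by ring)
  -- the L² bound of ∇_νG by the Schur test, per direction (components of the (3.42) majorants, transposes from the letters)
  have h1ν := hDS.left _ h1 ν
  have h2ν := hDS.right _ h2 ν
  have htrν : IsTransposePair (𝔡.Dd U ν ∘ₗ 𝔬.G U) (𝔬.G U ∘ₗ 𝔡.Dsd U ν) := hsym.comp (hDT.tr ν).symm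
  have hS1 := blockBd_entry1 hF hC hs.symm hs.lenpos 𝔬.blk 𝔬.blk h1ν h2ν htrν
  have hS : BlockBd (g := toB6 g R H) 𝔬.blk 𝔬.blk (𝔡.Dd U ν ∘ₗ 𝔬.G U)
      (fun (a b : g.Site) => C * L₀ * g.len a ^ (1 : ℝ) * Real.exp (-((1 - α) * δ * g.dist a b))) :=
    hS1.mono fun a b => by rw [Real.rpow_one]
  have hρ : (1 - α) * δ = α * δ + (1 - 2 * α) * δ := by ring
  have htail := comp_l2_transfer (R := R) (H := H) 𝔬.blk 𝔬.blk 𝔬.blk hF h261 htri hs.symm hs.dnn hs.lenpos (mul_nonneg hC hL₀)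
    (mul_nonneg hNF (mul_nonneg hθM hMinv0)) hρ hρ'0 hrate (by rw [abs_one]; norm_num) hS hP
  have hhead := blockBd_localSum (R := R) (H := H) 𝔬.blk 𝔬.blk
    (fun i => 𝔡.Dd U ν ∘ₗ ((mulOp (𝔬.h i) * 𝔬.Gsq U i * mulOp (𝔬.h i)) ∘ₗ 𝔡.Dsd U μ))
    (fun i (a : g.Site) => if a ∈ SM i then (1 : ℝ) else 0) (fun (a b : g.Site) => BM * Real.exp (-(δ₁ * g.dist a b))) NM
    (fun a b => mul_nonneg hBM (Real.exp_nonneg _)) (fun i => hL.lm i ν μ) hcntM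
  rw [hsplit]
  refine (blockBd_add₃ (R := R) (H := H) 𝔬.blk 𝔬.blk hhead htail).mono fun a b => ?_
  have hK0 : 0 ≤ NM * BM := mul_nonneg hNM hBM
  have h11 : L₀ ^ |(1 : ℝ)| = L₀ := by rw [abs_one, Real.rpow_one]
  have ht : C * L₀ * (NF * (θM * g.M⁻¹)) * L₀ ^ |(1 : ℝ)| * B6.c1 d₁ δ₁ α₁ ≤ C * L₀ * (NF * θM) * L₀ * B6.c1 d₁ δ₁ α₁ := by
    rw [h11]
    have h3 : θM * g.M⁻¹ ≤ θM := by
      calc θM * g.M⁻¹ ≤ θM * 1 := mul_le_mul_of_nonneg_left hMinv hθM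
        _ = θM := mul_one _
    have h4 : C * L₀ * (NF * (θM * g.M⁻¹)) ≤ C * L₀ * (NF * θM) :=
      mul_le_mul_of_nonneg_left (mul_le_mul_of_nonneg_left h3 hNF) (mul_nonneg hC hL₀)
    exact mul_le_mul_of_nonneg_right (mul_le_mul_of_nonneg_right h4 hL₀) hc1
  calc NM * (BM * Real.exp (-(δ₁ * g.dist a b))) +
        C * L₀ * (NF * (θM * g.M⁻¹)) * L₀ ^ |(1 : ℝ)| * B6.c1 d₁ δ₁ α₁ * Real.exp (-((1 - 2 * α) * δ * g.dist a b))
      = NM * BM * Real.exp (-(δ₁ * g.dist a b)) +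
        C * L₀ * (NF * (θM * g.M⁻¹)) * L₀ ^ |(1 : ℝ)| * B6.c1 d₁ δ₁ α₁ * Real.exp (-((1 - 2 * α) * δ * g.dist a b)) := by ring
    _ ≤ NM * BM * Real.exp (-((1 - 2 * α) * δ * g.dist a b)) +
        C * L₀ * (NF * θM) * L₀ * B6.c1 d₁ δ₁ α₁ * Real.exp (-((1 - 2 * α) * δ * g.dist a b)) :=
        add_le_add (mul_le_mul_of_nonneg_left (hexp a b) hK0) (mul_le_mul_of_nonneg_right ht (Real.exp_nonneg _))
    _ = mixedConst d₁ δ₁ α₁ NM BM NF θM C L₀ * Real.exp (-((1 - 2 * α) * δ * g.dist a b)) := by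
        unfold mixedConst; ring

/-- ★ **THE PACKAGED FAMILY ∇_{U,ν}G∇\*_{U,μ} OVER THE PAIRS (ν, μ) ∈ P × P** has the L² block bound |P|·`mixedConst …`·e^{−(1−2α)δd}
between the fibres of `blk` and `blk ∘ fst` (√|P × P| = |P|) — the model of def-Y's third L² member at the coordinate pins.
[cite: Balaban1985BackgroundPropagators, (3.46) p.398 + (3.39) p.397 («max_{μ,ν}»)] -/
theorem blockBd_mixed_family_dir [Fintype X] [DecidableEq X] [Fintype Y] [Fintype ι] [Fintype A]
    (𝔬 : Ops310 g B X Y ι A) (𝔡 : DirOps310 𝔬 P) (𝔩 : DirLetters310 𝔬 P) (R : ℝ) (H : Prop) (d d₁ : ℕ) (δ α L₀ δ₁ α₁ ρ N N' NF Cℓ NM BM θM C : ℝ)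
    (κ : Sizes310) (SM : ι → Finset g.Site) (U : B.Cfg)
    (hNF : 0 ≤ NF) (hNM : 0 ≤ NM) (hBM : 0 ≤ BM) (hθM : 0 ≤ θM) (hM : 1 ≤ g.M) (hC : 0 ≤ C)
    (hα2 : 2 * α * δ ≤ δ) (hα₁δ₁ : 0 ≤ α₁ * δ₁) (hrate : (1 - 2 * α) * δ ≤ (1 - α₁) * δ₁)
    (hs : StaticOK310 𝔬 ρ N N' NF Cℓ κ) (hcntM : ∀ a : g.Site, (∑ i, if a ∈ SM i then (1 : ℝ) else 0) ≤ NM)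
    (h261 : Ineq261 d₁ (toB6 g R H) δ₁ α₁) (hF : Facts347 g R H d δ α L₀) (hi : Identities310₂ 𝔬 𝔡 𝔩 R H U)
    (hL : L2MixedLegs310 𝔬 𝔡 R H SM BM δ₁ U) (hFL : FactorsL2Mixed310 𝔬 𝔡 R H θM δ₁ U)
    (hDS : DirSup310 𝔬 𝔡 R H U) (hDT : DirTranspose310 𝔬 𝔡 U)
    (h1 : HasMajorantHom (g := toB6 g R H) 𝔬.blk 𝔬.blkY (𝔬.D U ∘ₗ 𝔬.G U)
      (fun (a b : g.Site) => C * g.len a * Real.exp (-(δ * g.dist a b))))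
    (h2 : HasMajorantHom (g := toB6 g R H) 𝔬.blkY 𝔬.blk (𝔬.G U ∘ₗ 𝔬.Dstar U)
      (fun (a b : g.Site) => C * g.len a * Real.exp (-(δ * g.dist a b))))
    (hsym : IsTransposePair (𝔬.G U) (𝔬.G U)) :
    BlockBd (g := toB6 g R H) 𝔬.blk (𝔬.blk ∘ Prod.fst)
      (familyOp fun p : P × P => 𝔡.Dd U p.1 ∘ₗ (𝔬.G U ∘ₗ 𝔡.Dsd U p.2))
      (fun (a b : g.Site) => (Fintype.card P : ℝ) * mixedConst d₁ δ₁ α₁ NM BM NF θM C L₀ *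
        Real.exp (-((1 - 2 * α) * δ * g.dist a b))) := by
  have hL₀ : 0 ≤ L₀ := le_trans (le_trans zero_le_one hF.one_le_L) hF.L_le
  have hK : 0 ≤ mixedConst d₁ δ₁ α₁ NM BM NF θM C L₀ := mixedConst_nonneg hNM hBM hNF hθM hC hL₀
  have h := blockBd_familyOp (R := R) (H := H) 𝔬.blk 𝔬.blk (P := P × P)
    (T := fun p : P × P => 𝔡.Dd U p.1 ∘ₗ (𝔬.G U ∘ₗ 𝔡.Dsd U p.2))
    (fun a b => mul_nonneg hK (Real.exp_nonneg _))
    (fun p => l2mixed_of_local310_dir 𝔬 𝔡 𝔩 R H d d₁ δ α L₀ δ₁ α₁ ρ N N' NF Cℓ NM BM θM C κ SM U hNF hNM hBM hθM hM hC hα2 hα₁δ₁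
      hrate hs hcntM h261 hF hi hL hFL hDS hDT h1 h2 hsym p.1 p.2)
  refine h.mono fun a b => le_of_eq ?_
  rw [Fintype.card_prod, Nat.cast_mul, Real.sqrt_mul_self (Nat.cast_nonneg _)]
  ring

end GSide

end

end Literature.MathematicalPhysics.QuantumFieldTheory.Balaban1983to89.B9RWSums346MixedPairGDir
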